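import Summits.Ventures.PercRepro.S1FiveCircuitBase
import Summits.Ventures.PercRepro.S1CoreCapFinal
import Summits.Ventures.PercRepro.TriangleCapEightI
import Summits.Ventures.PercRepro.S1CellCaps5

/-!
# PercRepro — THE CELL `(11, 8)`: an `e`-free core of rank `11` with `19` points satisfies `RLS` at level `4`
(p2, gen 21; SUBCLAIM-S1 §6.4)

The three-cap cell inequality `cellOK14 11 8 13 105 651` holds by kernel: `s₃ ≤ cq3 8 = 13` (p3's exact `P(8) = 13`,
TriangleCapEightI), `s₄ ≤ 105` (p1's unconditional table at nullity `8`, S1CoreCapFinal — the cell needs `≤ 107`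
at this `s₅`; my own chain's `114` read `1.0217`) and `s₅ ≤ avgChain5b 8 = 651` (S1FiveCircuitBase — the chain
restarted from `s₅ ≤ 52` at nullity `4`). Exact-rational twin `0.9934` (mining/p2/g21/reprice21.py). The row
`p = 11` of the `q = 4` window now ends at `(11, 7)`.

* `cell_eleven_eight_chains` — `cellOK14 11 8 13 105 651 = true` (decide + kernel);
* **`c025_core_eleven_eight`** — the cell.
Axioms: standard.
-/

open scoped Matroid

namespace PercRepro

namespace S1

open Set

variable {α : Type}

/-- The capped cell `(11, 8)` with `s₃ ≤ 13`, `s₄ ≤ 105`, `s₅ ≤ 651`, by kernel. -/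
theorem cell_eleven_eight_chains : cellOK14 11 8 13 105 651 = true := by decide +kernel

/-- The chain value `avgChain5b 8 = 651`. -/
theorem avgChain5b_eight : avgChain5b 8 = 651 := by decide

/-- **THE CELL `(11, 8)`**: an `e`-free core of rank `11` with `19` points satisfies `RLS` at level `4`. -/
theorem c025_core_eleven_eight (M : Matroid α) [M.Finite] (hR : M.eRank = (11 : ℕ)) (hn : M.E.ncard = 19)
    (hfree : ∀ e ∈ M.E, ∃ A ⊆ M.E \ {e}, e ∉ M.closure A ∧ e ∉ M.closure ((M.E \ {e}) \ A)) :
    ThmN.RLS M 11 4 := by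
  have hd : M.E.encard = M.eRank + ((8 : ℕ) : ℕ∞) := by
    rw [hR, ← M.ground_finite.cast_ncard_eq, hn]
    push_cast
    ring
  have hP : {C : Set α | M.IsCircuit C ∧ C.ncard = 3}.ncard ≤ 13 := by
    have h := TriangleCap.core_ncard_triangles_le_cq3 M hfree hd
    rwa [show TriangleCap.cq3 8 = 13 by decide] at h
  have hS : {C : Set α | M.IsCircuit C ∧ C.ncard = 4}.ncard ≤ 105 :=
    ncard_fourCircuits_le_one_hundred_five_unconditional M hfree (by exact_mod_cast hd)
  have hS5 : {C : Set α | M.IsCircuit C ∧ C.ncard = 5}.ncard ≤ 651 := by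
    have h := ncard_fiveCircuits_le_avgChain5b 8 M hfree hd
    rwa [avgChain5b_eight] at h
  exact rls_of_cellOK14 M 11 8 13 105 651 (by norm_num) hR hn hfree hP hS hS5 (by norm_num)
    cell_eleven_eight_chains

end S1

end PercRepro
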